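import Summits.RiemannHypothesis.RiemannHypothesis.Theorems.ZetaStringKreinWindow
import Literature.NumberTheory.LFunctions.WeilSemilocalQuadratic
import HarnessLib

/-!
# ZetaStringSemilocal — definitions: the `S`-truncated screw function `Ψ_S` and its Kreĭn kernel `G_S` (column DBR; RH-FREE; defs only)

LINE 1 — LABEL: RH-FREE definitions (explicit finite prime sums subtracted from the archimedean wall `Ψ_∅`); no
positivity of anything is asserted here. bears_on: LADDER-RH B-D → B-P(P1) (cell rh-dbr ENGINE-TARGETS §3.1/§3.4: the
truncated strings `T^P`, `P = {prime powers of primes in S}`, need TREE NAMES so that typed `δ(N)` / `ℓ*(P)` statements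
and the hypothesis-style dictionary of `Theorems.ZetaStringSemilocalKernel` (p457721) can be instantiated by `rfl`;
rh-dbr-theory g9 call of record 2026-08-26T17:28:58Z (a)). WHAT THIS IS NOT: progress toward RH; naming `Ψ_S` says
nothing about the zeros of `ζ`.

Objects (M. Suzuki, J. Lond. Math. Soc. (2) 108 (2023) = arXiv:2206.03682, (1.1): `Ψ = Ψ_∅ − Σ_{n ≤ e^{|v|}} Λ(n) n^{-1/2}(|v| − log n)`
on bounded windows; A. Connes, Selecta Math. 5 (1999) §VII Thm 4: keep only the places `S ∪ {∞}`):
* `semilocalRamp S v = Σ_{1 ≤ n ≤ ⌊e^{|v|}⌋} Λ_S(n) n^{-1/2} (|v| − log n)` — the `S`-smooth ramp sum `R_S`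
  (coefficients `weilSemilocalCoeff S n = Λ(n)/√n` if `primeFactors n ⊆ S`, else `0`);
* `semilocalScrew S = archScrew − semilocalRamp S` — the `S`-TRUNCATED SCREW FUNCTION `Ψ_S` (`Ψ_∅ = archScrew`;
  `Ψ_{primes<q} = Ψ` on `|v| < log q`, `ZetaStringKernelWeilDictionary.zetaScrew_eq_semilocalScrew_of_abs_lt_log`);
* `semilocalKernel S = kreinKernel (semilocalScrew S)` — its Kreĭn kernel `G_S(t,u) = Ψ_S(t) + Ψ_S(u) − Ψ_S(t − u)`
  (the chord Gram of the truncated string `T^S` of ENGINE-TARGETS §3).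
The bridge lemma `semilocalScrew_eq S : ∀ v, semilocalScrew S v = archScrew v − Σ …` is literally the hypothesis `hΨ`
of every theorem in `Theorems.ZetaStringSemilocalKernel` / `…Rows` / `…KernelWeilDictionary`, so each of them
instantiates at the named object by `semilocalScrew_eq S` (sibling file `Theorems.ZetaStringSemilocalNamed`, namespace
`…ZetaStringArchWall.Semilocal`).
Deliberately NOT here: any theorem with content (they live in the sibling proof files).
-/

noncomputable section

-- D-0017: `Summit.<S>.<S>.…` is the designed namespace of a single-problem summit.
set_option linter.dupNamespace false

namespace Summit.RiemannHypothesis.RiemannHypothesis.Theorems.ZetaStringArchWall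

open Literature.NumberTheory.LFunctions Literature.Analysis.Complex
open scoped BigOperators

/-- RH-FREE object: the `S`-smooth ramp sum `R_S(v) = Σ_{1 ≤ n ≤ ⌊e^{|v|}⌋} Λ_S(n) n^{-1/2} (|v| − log n)`
(`Λ_S(n)/√n = weilSemilocalCoeff S n`: `Λ(n)/√n` when every prime factor of `n` lies in `S`, else `0`); the finite places
`p ∈ S` of Connes' `S`-local Weil sum (Connes 1999 §VII Thm 4) in Suzuki's screw-line coordinate. -/
def semilocalRamp (S : Finset ℕ) (v : ℝ) : ℝ :=
  ∑ n ∈ Finset.Icc 1 ⌊Real.exp |v|⌋₊, weilSemilocalCoeff S n * (|v| - Real.log n)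

/-- RH-FREE object: the `S`-TRUNCATED SCREW FUNCTION `Ψ_S := Ψ_∅ − R_S` — Suzuki's screw function with only the prime
powers of the primes in `S` kept (`Ψ_∅ = archScrew`; `Ψ_{primes < q} = Ψ` on `|v| < log q`); Suzuki 2023 (1.1) with the
prime sum restricted to `S`-smooth `n`. -/
def semilocalScrew (S : Finset ℕ) (v : ℝ) : ℝ := archScrew v - semilocalRamp S v

/-- RH-FREE object: the Kreĭn kernel `G_S(t,u) = Ψ_S(t) + Ψ_S(u) − Ψ_S(t − u)` of the `S`-truncated screw function
(complex-valued, for `IsPosSemidefKernelOn`); the kernel of Suzuki 2023 (1.4)–(1.5) with `Ψ_S` in place of `Ψ`. -/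
def semilocalKernel (S : Finset ℕ) : ℝ → ℝ → ℂ := kreinKernel (semilocalScrew S)

/-- Unfolding `R_S`. -/
theorem semilocalRamp_eq (S : Finset ℕ) (v : ℝ) :
    semilocalRamp S v = ∑ n ∈ Finset.Icc 1 ⌊Real.exp |v|⌋₊, weilSemilocalCoeff S n * (|v| - Real.log n) := rfl

/-- **The bridge**: `Ψ_S` satisfies, by `rfl`, the hypothesis `hΨ` under which every theorem of
`Theorems.ZetaStringSemilocalKernel` is stated. -/
theorem semilocalScrew_eq (S : Finset ℕ) : ∀ v : ℝ, semilocalScrew S v = archScrew v -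
    ∑ n ∈ Finset.Icc 1 ⌊Real.exp |v|⌋₊, weilSemilocalCoeff S n * (|v| - Real.log n) := fun _ => rfl

/-- `Ψ_S = Ψ_∅ − R_S` pointwise. -/
theorem semilocalScrew_eq_archScrew_sub (S : Finset ℕ) (v : ℝ) :
    semilocalScrew S v = archScrew v - semilocalRamp S v := rfl

/-- `G_S = kreinKernel Ψ_S`. -/
theorem semilocalKernel_eq (S : Finset ℕ) : semilocalKernel S = kreinKernel (semilocalScrew S) := rfl

/-- `G_S(t,u) = Ψ_S(t) + Ψ_S(u) − Ψ_S(t − u)`. -/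
theorem semilocalKernel_apply (S : Finset ℕ) (t u : ℝ) :
    semilocalKernel S t u = ((semilocalScrew S t + semilocalScrew S u - semilocalScrew S (t - u) : ℝ) : ℂ) := rfl

end Summit.RiemannHypothesis.RiemannHypothesis.Theorems.ZetaStringArchWall

end
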